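import Literature.AlgebraicGeometry.AbelianSchemes.AbelianSchemeQuotientPoincarePullback
import Literature.AlgebraicGeometry.AbelianSchemes.AbelianSchemeQuotientPoincareSlices
import Literature.AlgebraicGeometry.AbelianSchemes.AbelianSchemeOverMulNEtale
import Literature.AlgebraicGeometry.AbelianSchemes.AbelianSchemeOverMulNSurjective
import Literature.AlgebraicGeometry.AbelianSchemes.PoincarePullbackTorsion
import Literature.AlgebraicGeometry.AbelianSchemes.PoincareSheafMulN
import Literature.AlgebraicGeometry.AbelianSchemes.PoincareUniversalLocality
import Literature.AlgebraicGeometry.Modules.EquivariantStructureRestrict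
import HarnessLib

/-!
# The `[n]`-division step of the universal property of the dual pair of `A/K` (HECKE-LINK H2, D6 brick (u1)+(u2), part 1)

Layer `Literature/AlgebraicGeometry/AbelianSchemes`, namespace `Literature.AlgebraicGeometry.AbelianSchemes.AbelianSchemeOver`.
THEOREMS ONLY; no definition, no named fact, no instance, no notation, no `sorry`.

Setting of ★ `AbelianSchemeQuotientPoincarePullback` ((ii) part 1): `ψ : A → B := A/K` (★ `quotientMk`), `π : B → A` (★ `mulNDesc`,
`ψ ≫ π = [n]_A`), a dual pair `(Â, 𝒫)` of `A`, `𝒩₁ = (π × 1_Â)^*𝒫` on `B ×_S Â` (★ `poincarePullbackBundle`).  [MumfordAV1970] §15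
Thm. 1: to classify a line bundle `L` on `B_T` through `Â` one classifies `ψ_T^* L` — `(1_A × g̃)^*𝒫 ≅ ψ_T^* L` for some
`g̃ : T → Â` — and DIVIDES `g̃` BY `n`: for every `T₁ → T` and every `T₁`-valued point `a₁` of `Â` with `[n] a₁ = g̃|_{T₁}`
(the points of the fpqc cover `T ×_{g̃, Â, [n]} Â → T`),

  `ψ_{T₁}^* ((1_B × a₁)^* 𝒩₁) ≅ ψ_{T₁}^* (L|_{B_{T₁}})`            (`nonempty_pullback_division_iso`),

because `ψ_{T₁}^*(1_B × a₁)^*(π × 1)^*𝒫 = [n]_{A_{T₁}}^* (1_A × a₁)^*𝒫 ≅ (1_A × [n]a₁)^*𝒫 = (1_A × g̃)^*𝒫|_{T₁} ≅ ψ_T^*L|_{T₁}` — ★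
`nonempty_pullback_baseChangeToProd_whiskerRight_iso` ((1 × a) past (π × 1)), ★ `nonempty_pullback_mulN_baseChange_pullbackP_iso`
(«the dual of `[n]_A` is `[n]_Â`», which carries the hypotheses `S` reduced, locally Noetherian and the unit hypothesis `hD`), ★
`restrictSolutionIso`, ★ `squareIso`.  The two modules `(1_B × a₁)^*𝒩₁` and `L|_{B_{T₁}}` on `B_{T₁}` therefore differ only by their
`K`-descent data along the free quotient `ψ_{T₁}` — the CHARACTER CORRECTION of part 2 (`AbelianSchemeQuotientDualPairExistsLocal`,
over ★ `RelativeSpec/PullbackIsoDiscrepancy`).  Also here: the fpqc properties of the division cover `T ×_{g̃, Â, [n]} Â → T`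
(`flat/surjective/isAffineHom_fst_of_mulN`) and the plumbing `baseChangeHom_left_eq_whiskerRight_left'`, `mulN_left_comp_hom`,
`pow_left_eq_comp_mulN_left`.

Cell `hodgecm-mathlib`, HECKE-LINK socket (B) file (ii), D6 (u1)+(u2) (B-plan1 (g14) 2026-08-29 22:42Z; design review B-p20 (g9)).
HC_CM is proved only modulo the 7 printed citations until rung 0 closes; nothing here is about HC.

## References
* [MumfordAV1970] D. Mumford, *Abelian Varieties* (1970), §7 Thm. 4 (p. 72), §13 (p. 125), §15 Thm. 1 (p. 143).
* [MilneAV2008] J. S. Milne, *Abelian Varieties* (2008), I §8 (pp. 36–37), I §9 Thm. 9.1 (p. 42).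
* [GortzWedhorn2020] U. Görtz, T. Wedhorn, *Algebraic Geometry I*, 2nd ed. (2020), Section (4.7), Thm. 14.72.
-/

noncomputable section

-- `(A.baseChange f).X = (Over.pullback f).obj A.X` / `(A.X ⊗ B.X).left = A.prodLeft B` hold by `rfl` only.
set_option backward.isDefEq.respectTransparency false

universe u

open CategoryTheory CategoryTheory.Limits AlgebraicGeometry MonoidalCategory CartesianMonoidalCategory
open scoped MonObj

namespace Literature.AlgebraicGeometry.AbelianSchemes

namespace AbelianSchemeOver

open Literature.AlgebraicGeometry.RelativeSpec Literature.AlgebraicGeometry.AbelianVarieties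
  Literature.AlgebraicGeometry.Motives Literature.AlgebraicGeometry.Modules

/-! ## §0 Plumbing on base change of `S`-morphisms -/

section Plumbing

variable {S : Scheme.{u}} (A B : AbelianSchemeOver S)

/-- **`(v_T).left = (v ▷ T′).left`** for every `T′ : Over S`: the base change `v_{T′} = (Over.pullback T′.hom).map v` (★
`baseChangeHom`) and the whiskering `v ▷ T′` of the cartesian monoidal structure of `Over S` have the same underlying morphism
`A ×_S T′ → B ×_S T′` (both are `(pr_A ≫ v, pr_{T′})`; generalises ★ `baseChangeHom_left_eq_whiskerRight_left`).
[cite: GortzWedhorn2020, Section (4.7) (pp. 107–108)] -/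
theorem baseChangeHom_left_eq_whiskerRight_left' (T' : Over S) (v : A.X ⟶ B.X) :
    (baseChangeHom v T'.hom).left = (v ▷ T').left := by
  apply pullback.hom_ext
  · erw [Over.whiskerRight_left_fst]
  · erw [Over.whiskerRight_left_snd]

/-- `[n]_A` is an `S`-morphism: `[n].left ≫ (A → S) = (A → S)`. [cite: GortzWedhorn2020, Section (4.7), (4.7.1) (p. 108)] -/
@[reassoc]
theorem mulN_left_comp_hom (n : ℕ) : (A.mulN n).left ≫ A.X.hom = A.X.hom :=
  Over.w (A.mulN n)

/-- For a `T`-valued point `a : Over.mk f ⟶ A` of `A` (in `Over S`): `(aⁿ).left = a.left ≫ [n].left` (Mathlib `MonObj.comp_pow`).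
[cite: MumfordFogartyKirwan1994, Ch. 7 §2 Definition 7.1 (ii) (p. 129)] -/
theorem pow_left_eq_comp_mulN_left {T : Scheme.{u}} {f : T ⟶ S} (a : Over.mk f ⟶ A.X) (n : ℕ) :
    (a ^ n).left = a.left ≫ (A.mulN n).left := by
  rw [mulN_def, ← Over.comp_left, MonObj.comp_pow, Category.comp_id]

/-- `ψ_T ≫ π_T = (ψ ≫ π)_T` on underlying morphisms (functoriality of base change). [cite: GortzWedhorn2020, Section (4.7) (pp. 107–108)] -/
@[reassoc]
theorem baseChangeHom_left_comp_baseChangeHom_left {C : AbelianSchemeOver S} {T : Scheme.{u}} (f : T ⟶ S)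
    (v : A.X ⟶ B.X) (w : B.X ⟶ C.X) :
    (baseChangeHom v f).left ≫ (baseChangeHom w f).left = (baseChangeHom (v ≫ w) f).left := by
  rw [← Over.comp_left]
  exact congrArg Over.Hom.left ((Over.pullback f).map_comp v w).symm

end Plumbing

/-! ## §1 The division cover `T ×_{g̃, Â, [n]} Â → T` is fpqc -/

section Cover

variable {S : Scheme.{u}} (A : AbelianSchemeOver S) {T : Scheme.{u}} (g : T ⟶ A.X.left) {n : ℕ}
  (hn : ∀ s : S, (n : S.residueField s) ≠ 0)

include hn in
/-- The first projection `T ×_{g, A, [n]} A → T` of the division cover is FLAT (base change of the flat `[n]_A`, ★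
`flat_pow_id_left`). [cite: MumfordAV1970, §7 Thm. 4 (p. 72)] [cite: GortzWedhorn2020, Thm. 14.72] -/
theorem flat_fst_of_mulN : Flat (pullback.fst g (A.mulN n).left) := by
  haveI : Flat (A.mulN n).left := by rw [mulN_def]; exact A.flat_pow_id_left hn
  infer_instance

include hn in
/-- The first projection `T ×_{g, A, [n]} A → T` of the division cover is SURJECTIVE (base change of the surjective `[n]_A`, ★
`surjective_pow_id_left`). [cite: MumfordAV1970, §6 Application 2 (p. 62)] [cite: GortzWedhorn2020, Thm. 14.72] -/
theorem surjective_fst_of_mulN : Surjective (pullback.fst g (A.mulN n).left) := by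
  haveI : Surjective (A.mulN n).left := by rw [mulN_def]; exact A.surjective_pow_id_left hn
  infer_instance

include hn in
/-- The first projection `T ×_{g, A, [n]} A → T` of the division cover is FINITE (base change of the finite `[n]_A`, ★
`isFinite_pow_id_left`), in particular affine and quasi-compact. [cite: MumfordAV1970, §7 Thm. 4 (p. 72)] [cite: GortzWedhorn2020, Thm. 14.72] -/
theorem isFinite_fst_of_mulN : IsFinite (pullback.fst g (A.mulN n).left) := by
  haveI : IsFinite (A.mulN n).left := by rw [mulN_def]; exact A.isFinite_pow_id_left hn
  infer_instance

end Cover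

/-! ## §2 The division identity `ψ_{T₁}^* (1_B × a₁)^* 𝒩₁ ≅ ψ_{T₁}^* L|_{T₁}` -/

section Division

variable {S : Scheme.{u}} (A : AbelianSchemeOver S)
  {Y : Scheme.{u}} (u : S ⟶ Y) (K : Subgroup A.Sections) [IsCommMonObj A.X] {n : ℕ}
  (hK : ∀ σ : K, (σ : A.Sections) ^ n = 1)
  [Finite K] [Y.IsSeparated] [IsSeparated (A.X.hom ≫ u)] [S.IsSeparated]
  (hcov : ∀ x : A.left, ∃ O : (A.translationActionOver u K).StableAffineOpens, x ∈ O.1)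
  [LocallyOfFiniteType (A.X.hom ≫ u)] [IsLocallyNoetherian Y]
  (hG : ∃ _ : GrpObj (A.quotientOver u K), IsMonHom (A.quotientMk u K hcov))
  (hsm : Smooth (A.quotientOver u K).hom) (hgc : GeometricallyConnected (A.quotientOver u K).hom)
  (D : A.DualPair) [IsAffine Y]
  (hfree : ∀ (Ω : Type u) [Field Ω] [IsAlgClosed Ω] (x : Spec (.of Ω) ⟶ A.left) (σ : K), σ ≠ 1 →
    x ≫ (A.translation (σ : A.Sections)).left ≠ x)

/-- `𝒩₁` read through the whiskering `π ▷ Â` (★ `baseChangeHom_left_eq_whiskerRight_left`): `𝒩₁ ≅ (π ▷ Â)^*𝒫`.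
[cite: MumfordAV1970, §15 Thm. 1 (p. 143)] -/
theorem nonempty_poincarePullbackBundle_L_iso_pullback_whiskerRight :
    Nonempty ((A.poincarePullbackBundle u K hK hcov hG hsm hgc D hfree).L ≅
      (Scheme.Modules.pullback ((A.mulNDesc u K hK hcov : (A.quotientBy u K hcov hG hsm hgc).X ⟶ A.X) ▷ D.hat.X).left).obj D.P) :=
  ⟨(Scheme.Modules.pullbackCongr
    (A.baseChangeHom_left_eq_whiskerRight_left D (A.quotientBy u K hcov hG hsm hgc) (A.mulNDesc u K hK hcov))).app D.P⟩

variable [IsReduced S] [IsLocallyNoetherian S]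

/-- **THE DIVISION IDENTITY.**  For `S` reduced and locally Noetherian, the unit hypothesis `hD` (`𝒫|_{A × e_Â} ≅ 𝒪`), a module `L` on
`B_T` (`B := A/K`), an `S`-morphism `g̃ : T → Â` with `(1_A × g̃)^*𝒫 ≅ ψ_T^* L`, and `c : T₁ → T`, `a₁ : T₁ → Â` over `c ≫ f` with
`a₁ ≫ [n]_Â = c ≫ g̃` (a `T₁`-valued point of the division cover `T ×_{g̃, Â, [n]} Â`):
`ψ_{T₁}^* ((1_B × a₁)^* 𝒩₁) ≅ ψ_{T₁}^* ((1_B × c)^* L)` on `A_{T₁}` (`𝒩₁ = (π × 1)^*𝒫`, `ψ_{T₁} = (ψ)_{T₁}` ★ `baseChangeHom`,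
`1_B × c` = ★ `prodMap`).  Chain: `(1_B × a₁)^*(π × 1)^*𝒫 ≅ π_{T₁}^*(1_A × a₁)^*𝒫` (★ `nonempty_pullback_baseChangeToProd_whiskerRight_iso`);
`ψ_{T₁}^* π_{T₁}^* = [n]_{A_{T₁}}^*` (`ψ ≫ π = [n]`, ★ `quotientMk_comp_mulNDesc`, ★ `baseChangeHom_mulN`);
`[n]_{A_{T₁}}^*(1_A × a₁)^*𝒫 ≅ (1_A × a₁ⁿ)^*𝒫` (★ `nonempty_pullback_mulN_baseChange_pullbackP_iso`); `a₁ⁿ = c ≫ g̃`;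
`(1_A × (c ≫ g̃))^*𝒫 ≅ (1_A × c)^*(1_A × g̃)^*𝒫 ≅ (1_A × c)^* ψ_T^* L` (★ `restrictSolutionIso`); `(1_A × c)^* ψ_T^* ≅ ψ_{T₁}^* (1_B × c)^*`
(★ `restrictLeft_comp_baseChangeHom_left`, ★ `squareIso`). [cite: MumfordAV1970, §15 Thm. 1 (p. 143)] [cite: MilneAV2008, I §9 Thm. 9.1 (p. 42)] -/
theorem nonempty_pullback_division_iso
    (hD : Nonempty ((Scheme.Modules.pullback (DualPair.unitHatSlice D)).obj D.P ≅ SheafOfModules.unit _))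
    {T T₁ : Scheme.{u}} (f : T ⟶ S) (L : ((A.quotientBy u K hcov hG hsm hgc).baseChange f).X.left.Modules)
    (g : T ⟶ D.hat.X.left) (hg : g ≫ D.hat.X.hom = f)
    (eg : Nonempty (D.pullbackP f g hg ≅
      (Scheme.Modules.pullback (baseChangeHom (A.quotientMk u K hcov : A.X ⟶ (A.quotientBy u K hcov hG hsm hgc).X) f).left).obj L))
    (c : T₁ ⟶ T) (a₁ : T₁ ⟶ D.hat.X.left) (ha₁ : a₁ ≫ D.hat.X.hom = c ≫ f) (h : a₁ ≫ (D.hat.mulN n).left = c ≫ g) :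
    Nonempty ((Scheme.Modules.pullback
        (baseChangeHom (A.quotientMk u K hcov : A.X ⟶ (A.quotientBy u K hcov hG hsm hgc).X) (c ≫ f)).left).obj
        ((Scheme.Modules.pullback ((A.quotientBy u K hcov hG hsm hgc).baseChangeToProd D.hat (c ≫ f) a₁ ha₁)).obj
          (A.poincarePullbackBundle u K hK hcov hG hsm hgc D hfree).L) ≅
      (Scheme.Modules.pullback
        (baseChangeHom (A.quotientMk u K hcov : A.X ⟶ (A.quotientBy u K hcov hG hsm hgc).X) (c ≫ f)).left).obj
        ((Scheme.Modules.pullback ((A.quotientBy u K hcov hG hsm hgc).prodMap (c ≫ f) f c rfl)).obj L)) := by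
  -- notation-free abbreviations
  let B : AbelianSchemeOver S := A.quotientBy u K hcov hG hsm hgc
  let ψ : A.X ⟶ B.X := A.quotientMk u K hcov
  let π : B.X ⟶ A.X := A.mulNDesc u K hK hcov
  have hψπ : ψ ≫ π = A.mulN n := A.quotientMk_comp_mulNDesc u K hK hcov
  -- the `T₁`-valued point `a₁` as a morphism in `Over S`
  let p₁ : Over.mk (c ≫ f) ⟶ D.hat.X := Over.homMk a₁ ha₁
  have hp₁ : p₁.left = a₁ := rfl
  -- Step 1: `(1_B × a₁)^* 𝒩₁ ≅ π_{T₁}^* (1_A × a₁)^* 𝒫`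
  obtain ⟨i₀⟩ := A.nonempty_poincarePullbackBundle_L_iso_pullback_whiskerRight u K hK hcov hG hsm hgc D hfree
  obtain ⟨i₁⟩ := D.nonempty_pullback_baseChangeToProd_whiskerRight_iso (X := B) π (c ≫ f) a₁ ha₁
  -- Step 2: `ψ_{T₁}^* π_{T₁}^* = [n]_{A_{T₁}}^*`
  have hcomp : (baseChangeHom ψ (c ≫ f)).left ≫ (baseChangeHom π (c ≫ f)).left = ((A.baseChange (c ≫ f)).mulN n).left := by
    rw [A.baseChangeHom_left_comp_baseChangeHom_left B (c ≫ f) ψ π, hψπ, A.baseChangeHom_mulN (c ≫ f) n]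
  let i₂ : (Scheme.Modules.pullback (baseChangeHom ψ (c ≫ f)).left).obj
        ((Scheme.Modules.pullback (baseChangeHom π (c ≫ f)).left).obj (D.pullbackP (c ≫ f) a₁ ha₁)) ≅
      (Scheme.Modules.pullback ((A.baseChange (c ≫ f)).mulN n).left).obj (D.pullbackP (c ≫ f) a₁ ha₁) :=
    (Scheme.Modules.pullbackComp _ _).app _ ≪≫ (Scheme.Modules.pullbackCongr hcomp).app _
  -- Step 3: `[n]_{A_{T₁}}^* (1_A × a₁)^* 𝒫 ≅ (1_A × a₁ⁿ)^* 𝒫`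
  obtain ⟨i₃⟩ := D.nonempty_pullback_mulN_baseChange_pullbackP_iso hD (c ≫ f) p₁ n
  -- Step 4: `a₁ⁿ = c ≫ g̃`
  have hpow : (p₁ ^ n).left = c ≫ g := by rw [D.hat.pow_left_eq_comp_mulN_left p₁ n, hp₁, h]
  have hcg : (c ≫ g) ≫ D.hat.X.hom = c ≫ f := by rw [Category.assoc, hg]
  have i₄ : D.pullbackP (c ≫ f) (p₁ ^ n).left (Over.w _) = D.pullbackP (c ≫ f) (c ≫ g) hcg :=
    D.pullbackP_congr (c ≫ f) hpow _ _
  -- Step 5: `(1_A × (c ≫ g̃))^* 𝒫 ≅ (1_A × c)^* ψ_T^* L`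
  obtain ⟨eg⟩ := eg
  let i₅ : D.pullbackP (c ≫ f) (c ≫ g) hcg ≅
      (Scheme.Modules.pullback (A.prodMap (c ≫ f) f c rfl)).obj
        ((Scheme.Modules.pullback (baseChangeHom ψ f).left).obj L) :=
    A.restrictSolutionIso D.hat D.P c rfl hg eg
  -- Step 6: `(1_A × c)^* ψ_T^* L ≅ ψ_{T₁}^* (1_B × c)^* L` (the square `(1_A × c) ≫ ψ_T = ψ_{T₁} ≫ (1_B × c)`)
  have hsq : (baseChangeHom ψ (c ≫ f)).left ≫ B.prodMap (c ≫ f) f c rfl = A.prodMap (c ≫ f) f c rfl ≫ (baseChangeHom ψ f).left := by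
    rw [← A.restrictLeft_eq_prodMap f c, ← B.restrictLeft_eq_prodMap f c]
    exact (A.restrictLeft_comp_baseChangeHom_left B f c ψ).symm
  let i₆ := squareIso hsq L
  exact ⟨(Scheme.Modules.pullback (baseChangeHom ψ (c ≫ f)).left).mapIso
      ((Scheme.Modules.pullback (B.baseChangeToProd D.hat (c ≫ f) a₁ ha₁)).mapIso i₀ ≪≫ i₁) ≪≫
    i₂ ≪≫ i₃ ≪≫ eqToIso i₄ ≪≫ i₅ ≪≫ i₆.symm⟩

end Division

end AbelianSchemeOver

end Literature.AlgebraicGeometry.AbelianSchemes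

end
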